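import Summits.Ventures.HSemireg.WedgeHankelPairMixing
import Summits.Ventures.HSemireg.WedgeHankelSubstitution
import Summits.Ventures.HSemireg.WedgeHankelCoSiegelTower
import Summits.Ventures.HSemireg.WedgeHankelPureKernel

/-!
# Venture HSemireg — THE SECOND SYMMETRY GROUP (2): th-7's CLASS IS A `det`-SEMI-INVARIANT OF `GL_n` — `Pm M (w_n q) = det M · w_n q` for EVERY `M ∈ M_n(K)` — hence EVERY KERNEL
# `Kr(univ, w_n q, k)`, every image and the Siegel ideal are `GL_n`-STABLE subspaces of `⋀^k(K² ⊗ K^n)`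

HONEST FRAMING. Part of the Lean index of the computation cell `pub-hsemireg` (seat p10 gen 18, Sunday typer «UNIFORM-IN-n»).
Finite-dimensional EXTERIOR ALGEBRA over a field ONLY: no variety, no cohomology theory, no sheaf, no Ext group, no semiregularity map;
nothing here says that HC / HC_CM / HC_AV holds; no Literature fact is declared or used.  Custodian versions as in `WedgeHankelSiegelIdeal` (1/3) and `WedgeHankelFrameChange`;
the dictionary (th-7's class = the top wedge of the `n` vectors `u x_a + v y_a`, which `M ∈ GL_n` multiplies by `det M`; a kernel name that is NOT `GL_n`-stable cannot be the kernel of a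
`K[Θ]`-class) is QUOTED, never asserted.

WHAT IS IN THE TREE / KEYED.  H9 `WedgeHankelPairMixing` (this seat): `Pm M`, `Pm_mul`, `Pm_one`, `Pm_diagonal_w` (`= det·`), `Pm_transvection_w` (upward, `i < j`: fixed),
`Pm_transvection_X/Y`, `swapMat`, `Pm_swapMat_X/Y`, `Pm_swapMat_adj_w` (`= −`); H1 `linearMap_ext_xy`; E7 `Kr_mapEquiv` / `V_mapEquiv`; G6 `siegelIdeal_eq_iInf_Kr_w`; Mathlib's
`Matrix.diagonal_transvection_induction` (every square matrix is a product of transvections and one diagonal matrix).  THIS FILE (namespace `Summit.Ventures.HSemireg.Wedge.HankelPairMixing`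
continued):
* §150 **`Pm_swap_transvection_swap`**: `Pm τ ∘ Pm (transvection i j c) ∘ Pm τ = Pm (transvection (τ i) (τ j) c)` for every pair swap `τ` (generator check), hence by conjugating with the
  ADJACENT swap `(j, j+1)` (sign `(−1)² = 1`) and induction on the gap: **`Pm_transvection_w_of_gt`** (`j < i`: fixed as well) and **`Pm_transvection_w'`** (EVERY transvection fixes `w_n q`).
* §151 **`Pm_w_eq_det_smul`: `Pm M (w_n q) = det M · w_n q` for EVERY `M ∈ M_n(K)` and every `q`** (Mathlib's transvection–diagonal induction; multiplicativity `Pm_mul`) — th-7's classes are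
  `det`-SEMI-INVARIANTS of the pair-mixing group; singular `M` kill every class.
* §152 invertible `M`: `pmLin_mul`, `pmLin_one`, `pmEquiv`, **`PmE`** (`= mapEquiv`; `PmE_apply`); `V_smul_of_ne_zero` (kernels: gen 13 `Kr_smul`); **`map_PmE_Kr_w`: `PmE M (Kr(univ, w_n q, k)) =
  Kr(univ, w_n q, k)`** and **`map_PmE_V_w`** — EVERY KERNEL AND EVERY IMAGE OF A `K[Θ]`-CLASS IS `GL_n`-STABLE, in every degree, for every `q`; **`map_PmE_siegelIdeal`** (so is `SI_k`, G6).
  This is the structural reason every name in the lineage's atlas (planes `plane(a,b)`, Siegel / frame ideals, `xRich`, their `Φs`-translates and intersections) is built from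
  `GL_n`-equivariant pieces.
* §152′ **`Pm_comp_Sb`**: pair mixing commutes with every substitution of the letters (H1 `Sb`) — the two symmetry groups act jointly (`M₂(K) × M_n(K)` on `⋀(K² ⊗ K^n)`).
NOT typed here: the decomposition of `⋀^k(K² ⊗ K^n)` into `GL₂ × GL_n`-isotypic pieces (Cauchy / Howe; no representation theory is imported); anything Ext-side.  Class side only; new names only.
-/

open Module

namespace Summit.Ventures.HSemireg.Wedge.HankelPairMixing

open Summit.Ventures.HSemireg.Wedge Summit.Ventures.HSemireg.Wedge.Kunneth Summit.Ventures.HSemireg.Wedge.Hankel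
  Summit.Ventures.HSemireg.Wedge.BasisFree Summit.Ventures.HSemireg.Wedge.HankelSiegel Summit.Ventures.HSemireg.Wedge.HankelSiegelIdeal
  Summit.Ventures.HSemireg.Wedge.KunnethKernel Summit.Ventures.HSemireg.Wedge.HankelFrameChange

variable (K : Type*) [Field K] {n : ℕ}

/-! ## §150. Downward transvections, by conjugation with adjacent swaps -/

/-- **CONJUGATING A TRANSVECTION BY A PAIR SWAP: `Pm τ ∘ Pm (transvection i j c) ∘ Pm τ = Pm (transvection (τ i) (τ j) c)`** (`τ = swapMat a b`; checked on the letters). -/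
theorem Pm_swap_transvection_swap (a b i j : Fin n) (c : K) :
    (Pm K (swapMat K a b)).comp ((Pm K (Matrix.transvection i j c)).comp (Pm K (swapMat K (n := n) a b))) =
      Pm K (Matrix.transvection (Equiv.swap a b i) (Equiv.swap a b j) c) :=
  algHom_ext_XY K
    (fun e => by
      rw [AlgHom.comp_apply, AlgHom.comp_apply, Pm_swapMat_X, Pm_transvection_X, map_add, Pm_swapMat_X, Equiv.swap_apply_self, Pm_transvection_X]
      congr 1
      by_cases h : Equiv.swap a b e = j
      · rw [if_pos h, if_pos (by rw [← h, Equiv.swap_apply_self]), map_smul, Pm_swapMat_X]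
      · rw [if_neg h, if_neg (fun h' => h (by rw [h', Equiv.swap_apply_self])), map_zero])
    (fun e => by
      rw [AlgHom.comp_apply, AlgHom.comp_apply, Pm_swapMat_Y, Pm_transvection_Y, map_add, Pm_swapMat_Y, Equiv.swap_apply_self, Pm_transvection_Y]
      congr 1
      by_cases h : Equiv.swap a b e = j
      · rw [if_pos h, if_pos (by rw [← h, Equiv.swap_apply_self]), map_smul, Pm_swapMat_Y]
      · rw [if_neg h, if_neg (fun h' => h (by rw [h', Equiv.swap_apply_self])), map_zero])

/-- one conjugation step on the class: for `j + 1 < n` and `τ = (j, j+1)`, `Pm (transvection i j c) (w_n q) = −Pm τ (Pm (transvection (τ i) (j+1) c) (w_n q))`. -/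
lemma Pm_transvection_w_step (i j : Fin n) (hj1 : (j : ℕ) + 1 < n) (c : K) (q : ℕ → K) :
    Pm K (Matrix.transvection i j c) (w K n n q) =
      -Pm K (swapMat K j ⟨(j : ℕ) + 1, hj1⟩) (Pm K (Matrix.transvection (Equiv.swap j ⟨(j : ℕ) + 1, hj1⟩ i) ⟨(j : ℕ) + 1, hj1⟩ c) (w K n n q)) := by
  set j1 : Fin n := ⟨(j : ℕ) + 1, hj1⟩ with hj1def
  have key := Pm_swap_transvection_swap K j j1 (Equiv.swap j j1 i) (Equiv.swap j j1 j) c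
  rw [Equiv.swap_apply_self, Equiv.swap_apply_self] at key
  have e := AlgHom.congr_fun key (w K n n q)
  rw [AlgHom.comp_apply, AlgHom.comp_apply] at e
  have hsw : ∀ r : ℕ → K, Pm K (swapMat K j j1) (w K n n r) = -w K n n r := fun r => by
    have h := Pm_swapMat_adj_w K (n := n) (c := (j : ℕ)) hj1 r
    simp only [Fin.eta] at h
    exact h
  rw [← e, hsw, map_neg, map_neg, Equiv.swap_apply_left]

/-- **DOWNWARD TRANSVECTIONS FIX THE CLASS: `Pm (transvection i j c) (w_n q) = w_n q` for `j < i`** — induction on the gap `i − j − 1`: conjugating by the adjacent swap `(j, j+1)` costs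
`(−1)² = 1` and turns `(i, j)` into `(i, j+1)` (smaller gap) or, at gap `0`, into the UPWARD `(j, j+1)`. -/
theorem Pm_transvection_w_of_gt : ∀ (d : ℕ) {i j : Fin n}, (i : ℕ) = (j : ℕ) + 1 + d → ∀ (c : K) (q : ℕ → K), Pm K (Matrix.transvection i j c) (w K n n q) = w K n n q
  | 0, i, j, hd, c, q => by
    have hj1 : (j : ℕ) + 1 < n := by have := i.2; omega
    have hsw : Pm K (swapMat K j ⟨(j : ℕ) + 1, hj1⟩) (w K n n q) = -w K n n q := by
      have h := Pm_swapMat_adj_w K (n := n) (c := (j : ℕ)) hj1 q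
      simp only [Fin.eta] at h
      exact h
    have hi : Equiv.swap j ⟨(j : ℕ) + 1, hj1⟩ i = j := by
      rw [show i = ⟨(j : ℕ) + 1, hj1⟩ from Fin.ext (by simp [hd]), Equiv.swap_apply_right]
    rw [Pm_transvection_w_step K i j hj1, hi, Pm_transvection_w K (show j < (⟨(j : ℕ) + 1, hj1⟩ : Fin n) from Fin.lt_def.mpr (by simp)) c q, hsw, neg_neg]
  | d + 1, i, j, hd, c, q => by
    have hj1 : (j : ℕ) + 1 < n := by have := i.2; omega
    have hsw : Pm K (swapMat K j ⟨(j : ℕ) + 1, hj1⟩) (w K n n q) = -w K n n q := by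
      have h := Pm_swapMat_adj_w K (n := n) (c := (j : ℕ)) hj1 q
      simp only [Fin.eta] at h
      exact h
    have hi : Equiv.swap j ⟨(j : ℕ) + 1, hj1⟩ i = i :=
      Equiv.swap_apply_of_ne_of_ne (fun h => by have h' : (i : ℕ) = (j : ℕ) := congrArg Fin.val h; omega)
        (fun h => by have h' : (i : ℕ) = (j : ℕ) + 1 := congrArg Fin.val h; omega)
    rw [Pm_transvection_w_step K i j hj1, hi, Pm_transvection_w_of_gt d (i := i) (j := ⟨(j : ℕ) + 1, hj1⟩) (by simp; omega) c q, hsw, neg_neg]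

/-- **EVERY TRANSVECTION FIXES THE CLASS** (`i ≠ j`): `Pm (transvection i j c) (w_n q) = w_n q`. -/
theorem Pm_transvection_w' {i j : Fin n} (hij : i ≠ j) (c : K) (q : ℕ → K) : Pm K (Matrix.transvection i j c) (w K n n q) = w K n n q := by
  rcases lt_or_gt_of_ne hij with h | h
  · exact Pm_transvection_w K h c q
  · have h' := Fin.lt_def.mp h
    exact Pm_transvection_w_of_gt K ((i : ℕ) - ((j : ℕ) + 1)) (i := i) (j := j) (by omega) c q

/-! ## §151. The class is a determinant-semi-invariant of the pair-mixing group -/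

/-- **`Pm M (w_n(q)) = det M · w_n(q)` for EVERY `M ∈ M_n(K)` and every `q`** — th-7's classes are `det`-semi-invariants of `GL_n` (and are killed by every singular `M`):
Mathlib's transvection–diagonal induction, `Pm_diagonal_w`, `Pm_transvection_w'`, `Pm_mul`. -/
theorem Pm_w_eq_det_smul (M : Matrix (Fin n) (Fin n) K) (q : ℕ → K) : Pm K M (w K n n q) = M.det • w K n n q := by
  revert q
  refine Matrix.diagonal_transvection_induction (P := fun N : Matrix (Fin n) (Fin n) K => ∀ q : ℕ → K, Pm K N (w K n n q) = N.det • w K n n q) M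
    (fun D _ q => Pm_diagonal_w K D q) (fun t q => ?_) (fun A B hA hB q => ?_)
  · rw [Matrix.TransvectionStruct.det, one_smul]
    exact Pm_transvection_w' K t.hij t.c q
  · rw [Pm_mul, AlgHom.comp_apply, hB, map_smul, hA, smul_smul, Matrix.det_mul, mul_comm]

/-- singular pair mixings kill every class. -/
theorem Pm_w_eq_zero_of_det_eq_zero {M : Matrix (Fin n) (Fin n) K} (hM : M.det = 0) (q : ℕ → K) : Pm K M (w K n n q) = 0 := by
  rw [Pm_w_eq_det_smul, hM, zero_smul]

/-! ## §152. Invertible pair mixings: every kernel, every image and the Siegel ideal are `GL_n`-stable -/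

/-- `pmLin` is multiplicative (column convention). -/
theorem pmLin_mul (M N : Matrix (Fin n) (Fin n) K) : pmLin K (M * N) = pmLin K M ∘ₗ pmLin K (n := n) N :=
  linearMap_ext_xy K
    (fun a => by
      rw [pmLin_b_castAdd, LinearMap.comp_apply, pmLin_b_castAdd, map_sum]
      simp_rw [map_smul, pmLin_b_castAdd, Finset.smul_sum, smul_smul, Matrix.mul_apply, Finset.sum_smul]
      rw [Finset.sum_comm]
      exact Finset.sum_congr rfl fun c _ => Finset.sum_congr rfl fun d _ => by rw [mul_comm])
    (fun a => by
      rw [pmLin_b_natAdd, LinearMap.comp_apply, pmLin_b_natAdd, map_sum]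
      simp_rw [map_smul, pmLin_b_natAdd, Finset.smul_sum, smul_smul, Matrix.mul_apply, Finset.sum_smul]
      rw [Finset.sum_comm]
      exact Finset.sum_congr rfl fun c _ => Finset.sum_congr rfl fun d _ => by rw [mul_comm])

/-- `pmLin 1 = id`. -/
theorem pmLin_one : pmLin K (1 : Matrix (Fin n) (Fin n) K) = LinearMap.id :=
  linearMap_ext_xy K
    (fun a => by
      rw [pmLin_b_castAdd, LinearMap.id_apply, Finset.sum_eq_single a]
      · rw [Matrix.one_apply_eq, one_smul]
      · intro c _ hc; rw [Matrix.one_apply_ne hc, zero_smul]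
      · intro h; exact absurd (Finset.mem_univ a) h)
    (fun a => by
      rw [pmLin_b_natAdd, LinearMap.id_apply, Finset.sum_eq_single a]
      · rw [Matrix.one_apply_eq, one_smul]
      · intro c _ hc; rw [Matrix.one_apply_ne hc, zero_smul]
      · intro h; exact absurd (Finset.mem_univ a) h)

/-- **the INVERTIBLE pair mixing as a linear equivalence of the generators** (inverse: `M⁻¹`). -/
noncomputable def pmEquiv {M : Matrix (Fin n) (Fin n) K} (hM : M.det ≠ 0) : (In n → K) ≃ₗ[K] (In n → K) :=
  LinearEquiv.ofLinear (pmLin K M) (pmLin K M⁻¹)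
    (by rw [← pmLin_mul, Matrix.mul_nonsing_inv M (isUnit_iff_ne_zero.mpr hM), pmLin_one])
    (by rw [← pmLin_mul, Matrix.nonsing_inv_mul M (isUnit_iff_ne_zero.mpr hM), pmLin_one])

/-- **THE PAIR-MIXING AUTOMORPHISM `PmE hM := mapEquiv (pmEquiv hM)`** for `det M ≠ 0`. -/
noncomputable def PmE {M : Matrix (Fin n) (Fin n) K} (hM : M.det ≠ 0) : HT K (In n) ≃ₐ[K] HT K (In n) := mapEquiv K (pmEquiv K hM)

/-- `PmE hM` is `Pm M` on elements. -/
@[simp] theorem PmE_apply {M : Matrix (Fin n) (Fin n) K} (hM : M.det ≠ 0) (x : HT K (In n)) : PmE K hM x = Pm K M x := rfl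

/-- scaling a class by a unit changes no image space (kernels: gen 13's `HankelPureKernel.Kr_smul`). -/
theorem V_smul_of_ne_zero {I : Type*} [LinearOrder I] [Fintype I] (D : Finset I) (f : HT K I) {c : K} (hc : c ≠ 0) (a : ℕ) :
    V K I D (c • f) a = V K I D f a := by
  have e : LinearMap.mulRight K (c • f) = c • LinearMap.mulRight K f := LinearMap.ext fun x => mul_smul_comm c x f
  rw [V_eq_map, V_eq_map, e, Submodule.map_smul _ _ _ hc]

/-- **EVERY KERNEL OF A `K[Θ]`-CLASS IS `GL_n`-STABLE: `PmE hM (Kr(univ, w_n q, k)) = Kr(univ, w_n q, k)`** for every `M` with `det M ≠ 0`, every `q`, every `k`. -/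
theorem map_PmE_Kr_w {M : Matrix (Fin n) (Fin n) K} (hM : M.det ≠ 0) (q : ℕ → K) (k : ℕ) :
    (Kr K Finset.univ (w K n n q) k).map (PmE K (n := n) hM).toLinearMap = Kr K Finset.univ (w K n n q) k := by
  rw [PmE, ← Kr_mapEquiv, mapEquiv_apply]
  change Kr K Finset.univ (Pm K M (w K n n q)) k = _
  rw [Pm_w_eq_det_smul, HankelPureKernel.Kr_smul K _ hM]

/-- **EVERY IMAGE OF A `K[Θ]`-CLASS IS `GL_n`-STABLE: `PmE hM (V(univ, w_n q, k)) = V(univ, w_n q, k)`.** -/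
theorem map_PmE_V_w {M : Matrix (Fin n) (Fin n) K} (hM : M.det ≠ 0) (q : ℕ → K) (k : ℕ) :
    (V K (In n) Finset.univ (w K n n q) k).map (PmE K (n := n) hM).toLinearMap = V K (In n) Finset.univ (w K n n q) k := by
  rw [PmE, ← V_mapEquiv, mapEquiv_apply]
  change V K (In n) Finset.univ (Pm K M (w K n n q)) k = _
  rw [Pm_w_eq_det_smul, V_smul_of_ne_zero K _ _ hM]

/-- **THE SIEGEL IDEAL IS `GL_n`-STABLE: `PmE hM (SI_k) = SI_k`** (`k ≤ n`; G6: `SI_k = ⋂_q Kr(univ, w_n q, k)`). -/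
theorem map_PmE_siegelIdeal {M : Matrix (Fin n) (Fin n) K} (hM : M.det ≠ 0) {k : ℕ} (hk : k ≤ n) :
    (siegelIdeal K n k).map (PmE K (n := n) hM).toLinearMap = siegelIdeal K n k := by
  refine Submodule.eq_of_le_of_finrank_eq ?_ ((PmE K (n := n) hM).toLinearEquiv.finrank_map_eq _)
  rw [KernelDuality.siegelIdeal_eq_iInf_Kr_w K hk]
  rintro _ ⟨x, hx, rfl⟩
  refine (Submodule.mem_iInf _).mpr fun q => ?_
  rw [← map_PmE_Kr_w K hM q k]
  exact ⟨x, (Submodule.mem_iInf _).mp hx q, rfl⟩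

/-! ## §152′. The two symmetry groups commute -/

/-- **PAIR MIXING COMMUTES WITH EVERY SUBSTITUTION OF THE LETTERS: `Pm M ∘ Sb α β γ δ = Sb α β γ δ ∘ Pm M`** (they act on the two tensor factors of `K² ⊗ K^n`; checked on the letters) —
so `GL₂ × GL_n` (indeed `M₂(K) × M_n(K)`) acts on `⋀(K^{2n})`, and th-7's class spans a `det`-line for the second factor while transforming by the moment representation under the first. -/
theorem Pm_comp_Sb (M : Matrix (Fin n) (Fin n) K) (α β γ δ : K) :
    (Pm K M).comp (Sb K (n := n) α β γ δ) = (Sb K α β γ δ).comp (Pm K M) :=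
  algHom_ext_XY K
    (fun a => by
      rw [AlgHom.comp_apply, AlgHom.comp_apply, Sb_X, map_add, map_smul, map_smul, Pm_X, Pm_Y, map_sum]
      simp_rw [map_smul, Sb_X, smul_add, Finset.sum_add_distrib, smul_comm (M _ a) α, smul_comm (M _ a) β, ← Finset.smul_sum])
    (fun a => by
      rw [AlgHom.comp_apply, AlgHom.comp_apply, Sb_Y, map_add, map_smul, map_smul, Pm_X, Pm_Y, map_sum]
      simp_rw [map_smul, Sb_Y, smul_add, Finset.sum_add_distrib, smul_comm (M _ a) γ, smul_comm (M _ a) δ, ← Finset.smul_sum])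

/-- pointwise form. -/
theorem Pm_Sb (M : Matrix (Fin n) (Fin n) K) (α β γ δ : K) (x : HT K (In n)) : Pm K M (Sb K α β γ δ x) = Sb K α β γ δ (Pm K M x) := by
  rw [← AlgHom.comp_apply, Pm_comp_Sb, AlgHom.comp_apply]

end Summit.Ventures.HSemireg.Wedge.HankelPairMixing
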